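import Summits.BirchSwinnertonDyer.Rank1Residual.Additive.PadicBallLog
import Summits.BirchSwinnertonDyer.Rank1Residual.Additive.KobayashiHondaIso
import Summits.BirchSwinnertonDyer.Rank1Residual.Additive.KobayashiLogFssValues
import HarnessLib

/-!
# Honda points: `c(x) = P(i(x)) ∈ E₁(K)` for `x ∈ 𝔪_K` has `Λ(c(x)) = log_{F_ss}(x)`; every point of
# `E₁(K)` is a Honda point; hence `Λ(E₁(K)) ⊆ K' + 𝒪_K` whenever `p`-th powers of `𝒪_K` lie in
# `(K' ∩ 𝒪_K) + p𝒪_K` (cell `b2b-bsdres`, CLASS-CLOSURE lane, class O10 — x1b GEN 33, class lead;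
# file 31 of the local series: [K] §8.4, the points `c_n` and Prop. 8.11's `Λ_n ⊆ 𝔪_n + k_{n−1}`,
# for an abstract complete `K ⊇ ℚ_p`)

HONEST FRAMING (cell `b2b-bsdres`, run/shared/lean/b2b/bsd-rank1-residual/, verbatim in every
file): the goal of the cell is to DELETE the COMBINATION-SHAPED residual classes of the
Birch–Swinnerton-Dyer formula for ALL analytic-rank `≤ 1` elliptic curves over `ℚ` — "full BSD
formula for every rank `≤ 1` curve in class `C`" assembled STRICTLY from published theorems — so
that the rank-`≤ 1` remainder becomes exactly the CONSTRUCTION-SHAPED classes, which are TYPED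
(missing-input `Prop`s), NOT attempted. This is not "finishing BSD". CLASS-CLOSURE lane: prove
what is provable now; shrink each hard class to its core with data; no claim beyond stated classes;
research routes on CONSTRUCTION-SHAPED X12 / O10; census / instrument output = EVIDENCE / conjecture
items, NEVER a Literature fact; `RESIDUAL-MAP.md` marks change only by signed lines. THIS FILE:
TOOL DEFINITION + THEOREMS (one definition with body: `hondaPt`; every statement proved) — no
named Literature fact, no Summits-side fact `def … : Prop`, no `sorry`, axioms standard; nothing is
booked; no label / mark / count / sub-cell moves; O10 stays OPEN / CONSTRUCTION-SHAPED; nothing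
about `BSD(W, p)` of any pair is claimed.

## Content (`M/ℤ_p` good supersingular with `a_p = 0`, `p` odd; `K ⊇ ℚ_p` complete ultrametric;
## `i = hondaIso`, `j = hondaIsoInv`, `Λ = ptLog`)

* §1 `hondaPt x` (`= ptOf (i(x))`), `∈ E₁(K)`, `z(hondaPt x) = i(x)`;
  **`ptLog_hondaPt`: `Λ(hondaPt x) = log_{F_ss}(x)`** (`log_E ∘ i = log_{F_ss}` + `qEval_subst`).
* §2 **`exists_eq_hondaPt`**: every `P ∈ E₁(K)` is `hondaPt (j(z P))`; hence
  **`exists_mem_norm_ptLog_sub_le_one`**: `Λ(P) ∈ K' + 𝒪_K` for all `P ∈ E₁(K)` under the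
  Frobenius hypothesis on `(K, K')` (file 28).

References: [Kobayashi2003] §8.4 (`c_n`, Lemma 8.9, Prop. 8.11); [Honda1970] Thm. 2.
-/

noncomputable section

open scoped Classical Topology NNReal
open Filter PowerSeries

namespace Summit.BirchSwinnertonDyer.Rank1Residual.Additive

namespace BallEval

open Literature.NumberTheory.GaloisRepresentations.LubinTate (unitBall mem_unitBall_iff)
open Literature.NumberTheory.EllipticCurves Literature.NumberTheory.EllipticCurves.FormalGroupChart
open WeierstrassCurve HondaFss

variable (p : ℕ) [hp : Fact p.Prime] (K : Type*) [NontriviallyNormedField K] [NormedAlgebra ℚ_[p] K]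
  [IsUltrametricDist K] [CompleteSpace K] (M : WeierstrassCurve ℤ_[p])
  [hE : (M.map PadicInt.Coe.ringHom).IsElliptic] [hEt : (M.map PadicInt.toZMod).IsElliptic]
  (hp2 : p ≠ 2) (htr : Literature.NumberTheory.EllipticCurves.HasseManin.tr (M.map PadicInt.toZMod) = 0)

/-! ## §1 Honda points and their logarithms -/

variable {p K M} in
omit [CompleteSpace K] hE hEt in
/-- `‖g(x)‖ < 1` for `g ∈ Xℤ_p⟦X⟧` and `‖x‖ < 1` (restated for convenience). [folklore] -/
theorem norm_ev₁_lt_one_of_constantCoeff [CompleteSpace K] {g : ℤ_[p]⟦X⟧} (hg : constantCoeff g = 0)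
    {x : unitBall K} (hx : ‖(x : K)‖ < 1) :
    ‖((ev₁ p K x (hasEval_of_norm_lt_one hx) g : unitBall K) : K)‖ < 1 :=
  (norm_ev₁_le _ hx.le hg).trans_lt hx

/-- **The Honda point `c(x) = P(i(x)) ∈ E(K)`** of `x ∈ 𝔪_K`. [cite: Kobayashi2003, §8.4] -/
def hondaPt (x : unitBall K) (hx : ‖(x : K)‖ < 1) : (curveK p K M).toAffine.Point :=
  ptOf p K M (ev₁ p K x (hasEval_of_norm_lt_one hx) (hondaIso p M hp2 htr))
    (norm_ev₁_lt_one_of_constantCoeff (constantCoeff_hondaIso hp2 htr) hx)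

variable {p K M hp2 htr}
variable [hint : (curveK p K M).IsIntegral (NormedField.valuation (K := K)).integer]

/-- `c(x) ∈ E₁(K)`. [folklore] -/
theorem hondaPt_mem_kernel {x : unitBall K} (hx : ‖(x : K)‖ < 1) :
    hondaPt p K M hp2 htr x hx ∈ kernel (NormedField.valuation (K := K)) (curveK p K M) :=
  ptOf_mem_kernel _

omit hint in
/-- `z(c(x)) = i(x)`. [folklore] -/
theorem zCoord_hondaPt {x : unitBall K} (hx : ‖(x : K)‖ < 1) :
    (hondaPt p K M hp2 htr x hx).zCoord =
      ((ev₁ p K x (hasEval_of_norm_lt_one hx) (hondaIso p M hp2 htr) : unitBall K) : K) :=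
  zCoord_ptOf _

omit hint in
/-- **`Λ(c(x)) = log_{F_ss}(x)`**: `Λ(c(x)) = log_E(i(x)) = (log_E ∘ i)(x) = log_{F_ss}(x)`
(`qEval_subst` for the logarithmically growing `log_E` and the integral `i`).
[cite: Kobayashi2003, Lemma 8.9] -/
theorem ptLog_hondaPt {x : unitBall K} (hx : ‖(x : K)‖ < 1) :
    ptLog p K M (hondaPt p K M hp2 htr x hx) = qEval p K (logFss p) (x : K) := by
  rw [ptLog, zCoord_hondaPt, bLog, ← formalLog_subst_map_hondaIso hp2 htr]
  exact (qEval_subst (K := K) (norm_coeff_logQ_le (p := p) (M := M)) (constantCoeff_hondaIso hp2 htr) hx).symm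

/-! ## §2 Every point of `E₁(K)` is a Honda point -/

omit hint in
/-- `i(j(t)) = t` at points. [folklore] -/
theorem ev₁_hondaIso_ev₁_hondaIsoInv {t : unitBall K} (ht : ‖(t : K)‖ < 1) :
    ev₁ p K (ev₁ p K t (hasEval_of_norm_lt_one ht) (hondaIsoInv p M hp2 htr))
        (hasEval_of_norm_lt_one (norm_ev₁_lt_one_of_constantCoeff (constantCoeff_hondaIsoInv hp2 htr) ht))
        (hondaIso p M hp2 htr) = t := by
  rw [← ev₁_subst (constantCoeff_hondaIsoInv hp2 htr) (hasEval_of_norm_lt_one ht), hondaIso_subst_hondaIsoInv,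
    ev₁_X]

/-- **Every `P ∈ E₁(K)` is the Honda point of `x = j(z(P))`**, with `‖x‖ ≤ ‖z P‖`.
[cite: Kobayashi2003, §8.4] -/
theorem exists_eq_hondaPt {P : (curveK p K M).toAffine.Point}
    (hP : P ∈ kernel (NormedField.valuation (K := K)) (curveK p K M)) :
    ∃ (x : unitBall K) (hx : ‖(x : K)‖ < 1), P = hondaPt p K M hp2 htr x hx ∧ ‖(x : K)‖ ≤ ‖P.zCoord‖ := by
  set x : unitBall K := ev₁ p K (zBall P hP) (hasEval_of_norm_lt_one (norm_zBall_lt_one hP)) (hondaIsoInv p M hp2 htr)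
    with hxdef
  have hxle : ‖(x : K)‖ ≤ ‖P.zCoord‖ := norm_ev₁_le _ (norm_zBall_lt_one hP).le (constantCoeff_hondaIsoInv hp2 htr)
  have hx : ‖(x : K)‖ < 1 := hxle.trans_lt (norm_zCoord_lt_one hP)
  refine ⟨x, hx, ?_, hxle⟩
  refine eq_of_zCoord_eq hP (hondaPt_mem_kernel hx) ?_
  have h : ev₁ p K x (hasEval_of_norm_lt_one hx) (hondaIso p M hp2 htr) = zBall P hP :=
    ev₁_hondaIso_ev₁_hondaIsoInv (norm_zBall_lt_one hP)
  rw [zCoord_hondaPt, h]; rfl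

include hp2 htr in
/-- **`Λ(E₁(K)) ⊆ K' + 𝒪_K`** for a subfield `K'` with the Frobenius property (every `y ∈ 𝒪_K` has
`yᵖ ∈ (K' ∩ 𝒪_K) + p𝒪_K`): `Λ(P) = log_{F_ss}(x)` for the Honda parameter `x` of `P`, and file 28
(the hypotheses `p ≠ 2`, `a_p = 0`, good reduction enter through the Honda points).
[cite: Kobayashi2003, Prop. 8.11] -/
theorem exists_mem_norm_ptLog_sub_le_one (K' : Subfield K)
    (hFrob : ∀ y : K, ‖y‖ ≤ 1 → ∃ s ∈ K', ‖s‖ ≤ 1 ∧ ‖y ^ p - s‖ ≤ ‖(p : K)‖)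
    {P : (curveK p K M).toAffine.Point} (hP : P ∈ kernel (NormedField.valuation (K := K)) (curveK p K M)) :
    ∃ μ ∈ K', ‖ptLog p K M P - μ‖ ≤ 1 := by
  obtain ⟨x, hx, hPx, -⟩ := exists_eq_hondaPt (hp2 := hp2) (htr := htr) hP
  rw [hPx, ptLog_hondaPt]
  exact exists_mem_norm_qEval_logFss_sub_le_one K' hFrob hx

omit hint in
/-- **`Λ(c(x))` in closed form at a root of unity**: if `(1 + x)^{p^{2k}} = 1` for `k ≥ k₀` then
`Λ(c(x)) = ∑_{k<k₀} (−1)ᵏ((1+x)^{p^{2k}} − 1)/pᵏ` ([K] Lemma 8.9: `x = ζ_{p^{n+1}} − 1`, `k₀ = ⌊(n+1)/2⌋ + 1`).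
[cite: Kobayashi2003, Lemma 8.9] -/
theorem ptLog_hondaPt_eq_sum {x : unitBall K} (hx : ‖(x : K)‖ < 1) {k₀ : ℕ}
    (h : ∀ k, k₀ ≤ k → (1 + (x : K)) ^ p ^ (2 * k) = 1) :
    ptLog p K M (hondaPt p K M hp2 htr x hx) = ∑ k ∈ Finset.range k₀, logFssRow p K (x : K) k := by
  rw [ptLog_hondaPt, qEval_logFss_eq_sum_of_pow_eq_one hx h]

end BallEval

end Summit.BirchSwinnertonDyer.Rank1Residual.Additive

end
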